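import Literature.NumberTheory.EllipticCurves.RootNumberTableThreeLocalBridgeProofs
import Literature.NumberTheory.DiophantineGeometry.TateAlgorithmThreeExitValuesProofs
import HarnessLib

/-!
# Rizzo's Table II over `ℚ`: readings of the local row datum on the rational invariants

`Proofs` file (theorems only; no definition, no named fact) in topic
`NumberTheory/EllipticCurves`, companion of `RootNumberTableThreeLocalBridgeProofs`, seventh file
of the kernel discharge of `WeierstrassCurve.conductorExponent_eq_tableConductorExponentThree`
(cell `b2b-bsdres`, team n1011, ROW T-PAP3).  Along a relation `X = u^w · q` in `ℚ₃`
(`X ∈ ℤ₃` an invariant of the `3`-adic minimal model, `q ∈ ℚ` the corresponding invariant of the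
given equation, `u = C.u⁻¹`), the entries of the local row datum
(`TateAlgorithm.rowDatum_of_minimal`: `ord X = n`, `3^e ∣ X`, `3 ∤ X`, and the special-condition
datum `X₄ = 3^e(β² − 8B₄)`, `X₆ = 3^{e'}(−β³ + 12βB₄ − 24B₆)`) are READ as the inputs of
`Rizzo.ofInvariants` (`Rizzo.val3 q`, and the Booleans `c₆'² + 2 ≡ 3c_{4,e} (9)` of `Rizzo.tableII`):

* `val3_eq_of_addVal_eq`, `exists_val3_of_pow_dvd`, `val3_eq_of_not_three_dvd`,
  `padicValRat_eq_of_addVal_eq`, `addVal_toNat_eq_zero_of_not_dvd`;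
* `condExpOfInvariants_eq_of_shift_zero` / `…_of_shift_one` (Table II on the local reduced triple);
* `three_dvd_iff_sp` — **the special condition**: `3 ∣ B₆ ↔ (res9 c₆)² + 2 ≡ 3·c_{4,e}(a, res9 c₄) (mod 9)`
  (`TateAlgorithm.nine_dvd_sq_add_two_sub_iff` over `ℤ₃`, whose units are `±1 (mod 3)`, and the
  unit-part bookkeeping of `RootNumberTableThreeLocalBridgeProofs`).

## References

* O. G. Rizzo, Compositio Math. 136 (2003) 1–23, §1.1–1.2 (pp. 3–4) and Table II (p. 4). [Rizzo2003]
-/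

noncomputable section

open IsDiscreteValuationRing
open Literature.NumberTheory.DiophantineGeometry.TateAlgorithm

namespace Literature.NumberTheory.EllipticCurves

namespace Rizzo

variable {X : ℤ_[3]} {u : ℚ_[3]} {w : ℕ} {q : ℚ}

/-- `ord X = n ≥ 1` reads `v₃(q) = n − w·v(u)`. [cite: Rizzo2003, §1.1 (p. 3)] -/
theorem val3_eq_of_addVal_eq (hu : u ≠ 0) (h : (X : ℚ_[3]) = u ^ w * (q : ℚ_[3])) {n : ℕ}
    (hn : (addVal ℤ_[3] X).toNat = n) (h1 : 1 ≤ n) :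
    val3 q = ((n : ℤ) : WithTop ℤ).map fun m => m - w * u.valuation := by
  rw [addVal_toNat_eq_valuation] at hn
  have hne : X ≠ 0 := by intro h0; rw [h0, PadicInt.valuation_zero] at hn; omega
  have hq : q ≠ 0 := fun h' => hne ((eq_zero_iff_of_coe_eq hu h).mpr h')
  refine val3_of_ne_zero hq (w := w) ?_
  rw [padicValRat_eq_of_coe_eq hu hq h, hn]

/-- `3^e ∣ X` reads `v₃(q) = a − w·v(u)` with `a = ∞` (`X = 0 = q`) or `a = ord X ≥ e`.
[cite: Rizzo2003, §1.1 (p. 3)] -/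
theorem exists_val3_of_pow_dvd (hu : u ≠ 0) (h : (X : ℚ_[3]) = u ^ w * (q : ℚ_[3])) {e : ℕ}
    (he : (3 : ℤ_[3]) ^ e ∣ X) :
    ∃ a : WithTop ℤ, val3 q = a.map (fun m => m - w * u.valuation) ∧
      (∀ n : ℤ, a = n → (e : ℤ) ≤ n) ∧
      (a = ⊤ ∧ X = 0 ∨ a = ((X.valuation : ℤ) : WithTop ℤ) ∧ X ≠ 0) := by
  have h3 : Irreducible (3 : ℤ_[3]) := by simpa using PadicInt.irreducible_p (p := 3)
  by_cases h0 : X = 0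
  · have hq : q = 0 := (eq_zero_iff_of_coe_eq hu h).mp h0
    refine ⟨⊤, ?_, fun n hn => (WithTop.top_ne_coe hn).elim, Or.inl ⟨rfl, h0⟩⟩
    rw [hq]; simp [val3]
  · have hq : q ≠ 0 := fun h' => h0 ((eq_zero_iff_of_coe_eq hu h).mpr h')
    have hle : e ≤ X.valuation := by
      have := le_addVal_toNat_of_pow_dvd h3 h0 he
      rwa [addVal_toNat_eq_valuation] at this
    refine ⟨((X.valuation : ℤ) : WithTop ℤ), ?_, fun n hn => ?_, Or.inr ⟨rfl, h0⟩⟩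
    · refine val3_of_ne_zero hq (w := w) ?_
      rw [padicValRat_eq_of_coe_eq hu hq h]
    · have : (X.valuation : ℤ) = n := by exact_mod_cast WithTop.coe_injective hn
      omega

/-- `3 ∤ X` reads `v₃(q) = 0 − w·v(u)`. [cite: Rizzo2003, §1.1 (p. 3)] -/
theorem val3_eq_of_not_three_dvd (hu : u ≠ 0) (h : (X : ℚ_[3]) = u ^ w * (q : ℚ_[3]))
    (hnd : ¬ (3 : ℤ_[3]) ∣ X) :
    val3 q = ((0 : ℤ) : WithTop ℤ).map fun m => m - w * u.valuation := by
  have h3 : Irreducible (3 : ℤ_[3]) := by simpa using PadicInt.irreducible_p (p := 3)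
  have h0 : X ≠ 0 := fun h' => hnd (h' ▸ dvd_zero _)
  have hq : q ≠ 0 := fun h' => h0 ((eq_zero_iff_of_coe_eq hu h).mpr h')
  have hval : X.valuation = 0 := by
    have hunit : IsUnit X := (isUnit_iff_not_dvd h3 _).mpr hnd
    have := addVal_toNat_eq_valuation X
    rw [addVal_eq_zero_iff.mpr hunit] at this
    simpa using this.symm
  refine val3_of_ne_zero hq (n := 0) (w := w) ?_
  rw [padicValRat_eq_of_coe_eq hu hq h, hval]

/-- `ord X = c` reads `v₃(q) = c − w·v(u)` for `q ≠ 0`. [cite: Rizzo2003, §1.1 (p. 3)] -/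
theorem padicValRat_eq_of_addVal_eq (hu : u ≠ 0) (h : (X : ℚ_[3]) = u ^ w * (q : ℚ_[3]))
    (hq : q ≠ 0) {c : ℕ} (hc : (addVal ℤ_[3] X).toNat = c) :
    padicValRat 3 q = (c : ℤ) - w * u.valuation := by
  rw [padicValRat_eq_of_coe_eq hu hq h, ← addVal_toNat_eq_valuation, hc]

/-- `3 ∤ X` gives `ord X = 0`. [cite: Gouvea1993PadicNumbers, §3.3 (ℤ_p: the valuation v_p, units, p a uniformiser, ℤ_p/pⁿℤ_p ≅ ℤ/pⁿ)] -/
theorem addVal_toNat_eq_zero_of_not_dvd (hnd : ¬ (3 : ℤ_[3]) ∣ X) : (addVal ℤ_[3] X).toNat = 0 := by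
  have h3 : Irreducible (3 : ℤ_[3]) := by simpa using PadicInt.irreducible_p (p := 3)
  rw [addVal_eq_zero_iff.mpr ((isUnit_iff_not_dvd h3 _).mpr hnd)]; rfl

/-- `3` is a uniformiser of `ℤ₃` (Mathlib `PadicInt.irreducible_p`). [cite: Gouvea1993PadicNumbers, §3.3 (ℤ_p: the valuation v_p, units, p a uniformiser, ℤ_p/pⁿℤ_p ≅ ℤ/pⁿ)] -/
theorem irreducible_three_padicInt : Irreducible (3 : ℤ_[3]) := by
  simpa using PadicInt.irreducible_p (p := 3)

/-- `0 ≤ a` in `WithTop ℤ` from a "≥ e" reading. [cite: Rizzo2003, §1.1 (p. 3) (reading of the entries "≥ k" and of the shift m)] -/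
theorem nonneg_of_forall_coe {a : WithTop ℤ} {e : ℕ} (h : ∀ n : ℤ, a = n → (e : ℤ) ≤ n) :
    (0 : WithTop ℤ) ≤ a := by
  cases a with
  | top => exact le_top
  | coe n => have := h n rfl; exact_mod_cast (show (0 : ℤ) ≤ n by omega)

/-- **Table II on the local reduced triple, shift `0`.** [cite: Rizzo2003, §1.1–1.2 (pp. 3–4)] -/
theorem condExpOfInvariants_eq_of_shift_zero {q₄ q₆ qΔ : ℚ} {a b : WithTop ℤ} {c k : ℤ}
    (h4 : val3 q₄ = a.map fun m => m - 4 * k) (h6 : val3 q₆ = b.map fun m => m - 6 * k)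
    (hΔ : padicValRat 3 qΔ = c - 12 * k) (hs : KellockDokchitser.shift c b a = 0) :
    condExpOfInvariants q₄ q₆ qΔ = (tableII a b c (res9 q₄) (res9 q₆) (res9 qΔ)).2.1 := by
  unfold condExpOfInvariants
  rw [ofInvariants_eq_tableII_of_val3 h4 h6 hΔ, hs]
  have e4 : a.map (fun m : ℤ => m - 4 * 0) = a := by cases a with | top => rfl | coe n => simp
  have e6 : b.map (fun m : ℤ => m - 6 * 0) = b := by cases b with | top => rfl | coe n => simp
  rw [e4, e6]
  simp

/-- **Table II on the local reduced triple, shift `1`** (the ★ rows). [cite: Rizzo2003, §1.1–1.2 (pp. 3–4)] -/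
theorem condExpOfInvariants_eq_of_shift_one {q₄ q₆ qΔ : ℚ} {a b : WithTop ℤ} {c k : ℤ}
    (h4 : val3 q₄ = a.map fun m => m - 4 * k) (h6 : val3 q₆ = b.map fun m => m - 6 * k)
    (hΔ : padicValRat 3 qΔ = c - 12 * k) (hs : KellockDokchitser.shift c b a = 1) :
    condExpOfInvariants q₄ q₆ qΔ =
      (tableII (a.map fun m => m - 4) (b.map fun m => m - 6) (c - 12)
        (res9 q₄) (res9 q₆) (res9 qΔ)).2.1 := by
  unfold condExpOfInvariants
  rw [ofInvariants_eq_tableII_of_val3 h4 h6 hΔ, hs]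
  simp

/-- **The special condition of Table II, read in `ℤ₃`.**  Let `X₄ = u⁴c₄`, `X₆ = u⁶c₆` (the
invariants of the `3`-adic minimal model against those of the equation), and let the local row datum
give `X₄ = 3^e(β² − 8B₄)`, `X₆ = 3^{e'}(−β³ + 12βB₄ − 24B₆)` with `β ∈ ℤ₃ˣ` and `ord X₆ = e'`.
Then `3 ∣ B₆` iff Rizzo's condition `c₆'² + 2 ≡ 3c_{4,e} (mod 9)` holds on the residues
`res9 c₆`, `res9 c₄` and the reduced entry `a` of `c₄` (`∞` or `ord X₄`).  Proof:
`9 ∣ C₆² + 2 − 3C₄ ↔ 3 ∣ B₆` (`TateAlgorithm.nine_dvd_sq_add_two_sub_iff`, units of `ℤ₃` are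
`±1 (mod 3)`), and in `ℤ/9` the class of `C₆` is `res9 c₆` (`u₀⁶ ≡ 1`), that of `3C₄` is
`3·res9 c₄·3^{ord X₄ − e}` (`3u₀⁴ ≡ 3`). [cite: Rizzo2003, Table II (p. 4), special conditions] -/
theorem three_dvd_iff_sp (hu : u ≠ 0) {X₄ X₆ : ℤ_[3]} {q₄ q₆ : ℚ}
    (hc4 : (X₄ : ℚ_[3]) = u ^ 4 * (q₄ : ℚ_[3])) (hc6 : (X₆ : ℚ_[3]) = u ^ 6 * (q₆ : ℚ_[3]))
    (e e' : ℕ) (β B₄ B₆ : ℤ_[3]) (hβ : IsUnit β)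
    (hC4 : X₄ = 3 ^ e * (β ^ 2 - 8 * B₄)) (hC6 : X₆ = 3 ^ e' * (-β ^ 3 + 12 * β * B₄ - 24 * B₆))
    (hv6 : (addVal ℤ_[3] X₆).toNat = e') (h1 : 1 ≤ e')
    (a : WithTop ℤ) (hcase : a = ⊤ ∧ X₄ = 0 ∨ a = ((X₄.valuation : ℤ) : WithTop ℤ) ∧ X₄ ≠ 0) :
    ((3 : ℤ_[3]) ∣ B₆ ↔ (res9 q₆ ^ 2 + 2) % 9 = 3 * c4e a (res9 q₄) e % 9) := by
  have h3 : Irreducible (3 : ℤ_[3]) := by simpa using PadicInt.irreducible_p (p := 3)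
  have h3c : ((3 : ℤ_[3]) : ℚ_[3]) = 3 := by
    have := PadicInt.coe_natCast (p := 3) 3
    simpa using this
  set C₄ : ℤ_[3] := β ^ 2 - 8 * B₄ with hC₄def
  set C₆ : ℤ_[3] := -β ^ 3 + 12 * β * B₄ - 24 * B₆ with hC₆def
  rw [← nine_dvd_sq_add_two_sub_iff h3 three_dvd_sq_sub_one hβ B₄ B₆,
    show (9 : ℤ_[3]) = 3 ^ 2 by norm_num]
  have h6ne : X₆ ≠ 0 := by
    intro h0; rw [h0] at hv6; simp at hv6; omega
  have hq6 : q₆ ≠ 0 := fun h => h6ne ((eq_zero_iff_of_coe_eq hu hc6).mpr h)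
  have hv6' : padicValRat 3 q₆ = (e' : ℤ) - (6 : ℕ) * u.valuation := by
    rw [padicValRat_eq_of_coe_eq hu hq6 hc6, ← addVal_toNat_eq_valuation, hv6]
  have hcast6 : (3 : ℚ_[3]) ^ e' * (C₆ : ℚ_[3]) = u ^ 6 * (q₆ : ℚ_[3]) := by
    rw [← hc6, hC6]; push_cast [h3c]; ring
  obtain ⟨z, hz, hz6⟩ := exists_toZModPow_two_eq hu hq6 hcast6 hv6'
  rw [pow_six_eq_one_of_isUnit_zmod_nine z hz, one_mul] at hz6
  apply nine_dvd_sq_add_two_sub_iff_emod hz6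
  rcases hcase with ⟨rfl, h40⟩ | ⟨rfl, h4ne⟩
  · -- `c₄ = 0`
    have hC40 : C₄ = 0 := by
      have : (3 : ℤ_[3]) ^ e * C₄ = 0 := by rw [← hC4, h40]
      rcases mul_eq_zero.mp this with h | h
      · exact absurd h (pow_ne_zero _ h3.ne_zero)
      · exact h
    show PadicInt.toZModPow 2 (3 * C₄) = _
    rw [hC40, mul_zero, map_zero]
    simp [c4e]
  · -- `c₄ ≠ 0`: unit part `X` with `X₄ = 3^{n₄} X`, `C₄ = 3^{n₄ − e} X`
    set n₄ := X₄.valuation with hn₄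
    have hq4 : q₄ ≠ 0 := fun h => h4ne ((eq_zero_iff_of_coe_eq hu hc4).mpr h)
    have hle : e ≤ n₄ := by
      have := le_addVal_toNat_of_pow_dvd h3 h4ne ⟨_, hC4⟩
      rwa [addVal_toNat_eq_valuation] at this
    obtain ⟨d, hd⟩ := Nat.exists_eq_add_of_le hle
    set X : ℤ_[3] := (PadicInt.unitCoeff h4ne : ℤ_[3]) with hXdef
    have hX : X₄ = 3 ^ n₄ * X := by
      have := PadicInt.unitCoeff_spec h4ne
      rw [← hn₄] at this
      rw [this]; push_cast; ring
    have hv4 : padicValRat 3 q₄ = (n₄ : ℤ) - (4 : ℕ) * u.valuation := by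
      rw [padicValRat_eq_of_coe_eq hu hq4 hc4]
    have hcast4 : (3 : ℚ_[3]) ^ n₄ * (X : ℚ_[3]) = u ^ 4 * (q₄ : ℚ_[3]) := by
      rw [← hc4, hX]; push_cast [h3c]; ring
    obtain ⟨z', hz', hz4⟩ := exists_toZModPow_two_eq hu hq4 hcast4 hv4
    have hC4X : C₄ = 3 ^ d * X := by
      have h33 : (3 : ℤ_[3]) ^ e * C₄ = (3 : ℤ_[3]) ^ e * (3 ^ d * X) := by
        rw [← hC4, hX, hd, pow_add]; ring
      exact mul_left_cancel₀ (pow_ne_zero _ h3.ne_zero) h33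
    show PadicInt.toZModPow 2 (3 * C₄) = _
    rw [hC4X]
    rw [show (3 : ℤ_[3]) * (3 ^ d * X) = 3 ^ (d + 1) * X by ring, map_mul, map_pow, hz4,
      map_ofNat]
    have hc4e : c4e ((n₄ : ℤ) : WithTop ℤ) (res9 q₄) e = res9 q₄ * 3 ^ d := by
      have ht : ((n₄ : ℤ) - (e : ℤ)).toNat = d := by omega
      show res9 q₄ * 3 ^ ((n₄ : ℤ) - (e : ℤ)).toNat = _
      rw [ht]
    rw [hc4e]
    push_cast
    cases d with
    | zero =>
      simp only [pow_zero, mul_one, zero_add, pow_one]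
      rw [← mul_assoc, three_mul_pow_four_mul_of_isUnit_zmod_nine z' _ hz']
    | succ d =>
      have h9 : (3 : ZMod (3 ^ 2)) ^ 2 = 0 := by decide
      rw [show (3 : ZMod (3 ^ 2)) ^ (d + 1 + 1) * (z' ^ 4 * (res9 q₄ : ZMod (3 ^ 2))) =
          3 ^ 2 * (3 ^ d * (z' ^ 4 * (res9 q₄ : ZMod (3 ^ 2)))) by ring,
        show (3 : ZMod (3 ^ 2)) * ((res9 q₄ : ZMod (3 ^ 2)) * 3 ^ (d + 1)) =
          3 ^ 2 * (3 ^ d * (res9 q₄ : ZMod (3 ^ 2))) by ring, h9, zero_mul, zero_mul]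

/-! ### Local shifts -/

/-- The local shift vanishes when `0 ≤ v(Δ)` and one of `⌊v(Δ)/12⌋, ⌊v(c₆)/6⌋, ⌊v(c₄)/4⌋`
vanishes, the valuations being non-negative. [cite: Rizzo2003, §1.1 (p. 3)] -/
theorem shift_eq_zero {c : ℤ} {b a : WithTop ℤ} (hc : 0 ≤ c) (hb : 0 ≤ b) (ha : 0 ≤ a)
    (hmin : c < 12 ∨ (∃ m : ℤ, b = m ∧ m < 6) ∨ (∃ n : ℤ, a = n ∧ n < 4)) :
    KellockDokchitser.shift c b a = 0 := by
  unfold KellockDokchitser.shift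
  cases b with
  | top =>
    cases a with
    | top =>
      dsimp only
      rcases hmin with h | ⟨m, hm, -⟩ | ⟨n, hn, -⟩
      · omega
      · exact absurd hm WithTop.top_ne_coe
      · exact absurd hn WithTop.top_ne_coe
    | coe n =>
      have hn0 : 0 ≤ n := by exact_mod_cast ha
      dsimp only
      rcases hmin with h | ⟨m, hm, -⟩ | ⟨n', hn', hlt⟩
      · omega
      · exact absurd hm WithTop.top_ne_coe
      · have : n = n' := by exact_mod_cast hn'
        omega
  | coe m =>
    have hm0 : 0 ≤ m := by exact_mod_cast hb
    cases a with
    | top =>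
      dsimp only
      rcases hmin with h | ⟨m', hm', hlt⟩ | ⟨n, hn, -⟩
      · omega
      · have : m = m' := by exact_mod_cast hm'
        omega
      · exact absurd hn WithTop.top_ne_coe
    | coe n =>
      have hn0 : 0 ≤ n := by exact_mod_cast ha
      dsimp only
      rcases hmin with h | ⟨m', hm', hlt⟩ | ⟨n', hn', hlt⟩
      · omega
      · have : m = m' := by exact_mod_cast hm'
        omega
      · have : n = n' := by exact_mod_cast hn'
        omega

/-- The local shift of the ★ row `(5, 8, 12)` is `1`. [cite: Rizzo2003, §1.1 (p. 3) and Table II] -/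
theorem shift_12_8_5 : KellockDokchitser.shift 12 8 5 = 1 := by
  decide

/-- The local shift of the ★ rows `(≥6, 8, 13)` is `1`. [cite: Rizzo2003, §1.1 (p. 3) and Table II] -/
theorem shift_13_8 {a : WithTop ℤ} (ha : 6 ≤ a) : KellockDokchitser.shift 13 8 a = 1 := by
  unfold KellockDokchitser.shift
  cases a with
  | top => decide
  | coe n =>
    have : (6 : ℤ) ≤ n := WithTop.coe_le_coe.mp (by simpa using ha)
    show min (min ((13 : ℤ) / 12) (8 / 6)) (n / 4) = 1
    omega

/-- `k ≤ a` in `WithTop ℤ` from the coerced reading. [cite: Rizzo2003, §1.1 (p. 3) (reading of the entries "≥ k" and of the shift m)] -/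
theorem coe_le_of_forall_coe {a : WithTop ℤ} {k : ℤ} (h : ∀ n : ℤ, a = n → k ≤ n) :
    (k : WithTop ℤ) ≤ a := by
  cases a with
  | top => exact le_top
  | coe n => exact_mod_cast h n rfl

/-- `atLeast a k` from the coerced reading. [cite: Rizzo2003, §1.1 (p. 3) (reading of the entries "≥ k" and of the shift m)] -/
theorem atLeast_of_forall_coe {a : WithTop ℤ} {k : ℤ} (h : ∀ n : ℤ, a = n → k ≤ n) :
    KellockDokchitser.atLeast a k = true := by
  cases a with
  | top => rfl
  | coe n => simp [KellockDokchitser.atLeast, h n rfl]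

/-- `a ≠ j` for a numeral `j < k` from the coerced reading `a ≥ k`. [cite: Rizzo2003, §1.1 (p. 3) (reading of the entries "≥ k" and of the shift m)] -/
theorem ne_coe_of_forall_coe {a : WithTop ℤ} {k j : ℤ} (h : ∀ n : ℤ, a = n → k ≤ n) (hj : j < k) :
    a ≠ (j : WithTop ℤ) := by
  intro hja
  have := h j hja
  omega

/-- Reduction by the zero shift. [cite: Rizzo2003, §1.1 (p. 3) (reading of the entries "≥ k" and of the shift m)] -/
theorem map_sub_mul_zero (a : WithTop ℤ) (w : ℤ) : a.map (fun n => n - w * 0) = a := by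
  cases a with
  | top => rfl
  | coe n => simp

end Rizzo

end Literature.NumberTheory.EllipticCurves

end
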